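import Mathlib
import Summits.KontsevichZagierPeriods.Zeta5Search.Families.BasicGrowthEntropy
import Summits.KontsevichZagierPeriods.Zeta5Search.Families.BasicGrowthTwoFactor
import HarnessLib

/-!
# ζ(5) search — Families: the six-point growth constant is Apéry's number — `M_{₆π} = (√2 − 1)⁴` exactly

HONEST FRAMING: systematic search; no irrationality claim unless certified.  STRUCTURAL / elementary (size of Brown's
basic cellular integrals for his `N = 6` plan `₆π = (1,4,2,6,3,5)` [Brown2016, §1.5, App. 2 — the plan reproducing Apéry's
`ζ(3)` sequences]); nothing about the arithmetic of any zeta value.  Seat P2, Families layer.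

`Families/BasicGrowthFive.lean` proved `M_{₅π} = φ⁻⁵`.  Here, by the WEAK CAPACITY DUALITY of
`Families/BasicGrowthEntropy.lean` with the explicit optimal doubly stochastic plan (entries in `ℚ(√2)`, the Sinkhorn
scaling of the edge–gap interval matrix, found numerically in `HOME/pub-zeta5-p2/g4/` and verified here exactly):

* `fSigma_sigma6` — `f_{₆π}(t) = t₀(t₁−t₀)(t₂−t₁)(1−t₂) / (t₂ (t₂−t₀)(1−t₁))`;
* **`fSup_sigma6_le_apery`** — `M_{₆π} ≤ (√2−1)⁴` (`= e^{−H(B*)}`: the entropy of the optimal plan is `−4 log(√2−1)` EXACTLY);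
* `fSigma_sigma6_tStar` — at `t* = (√2−1, 2−√2, √2/2)` the value is `(√2−1)⁴`;
* **`fSup_sigma6`** — **`M_{₆π} = (√2−1)⁴ = 17 − 12√2 = 0.0294372…`**, Apéry's constant: `I_{₆π}(N)^{1/N} → (√2−1)⁴`
  (`tendsto_six_root`), `I_{₆π}(N) ≤ (√2−1)^{4N} I_{₆π}(0)` (`integral_six_le`).
Standard axioms only.
-/

noncomputable section

open MeasureTheory Set Finset Filter Topology

namespace Summit.KontsevichZagierPeriods.Zeta5Search.Families.Cellular

/-! ### `√2` bookkeeping -/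

/-- `1.41 < √2 < 1.42`. -/
theorem sqrt_two_bounds : (1.41 : ℝ) < Real.sqrt 2 ∧ Real.sqrt 2 < 1.42 := by
  constructor
  · rw [show (1.41 : ℝ) = Real.sqrt (1.41 ^ 2) by rw [Real.sqrt_sq (by norm_num)]]
    exact Real.sqrt_lt_sqrt (by norm_num) (by norm_num)
  · rw [show (1.42 : ℝ) = Real.sqrt (1.42 ^ 2) by rw [Real.sqrt_sq (by norm_num)]]
    exact Real.sqrt_lt_sqrt (by norm_num) (by norm_num)

/-! ### The six-point function -/

/-- The open simplex in dimension three. -/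
theorem mem_openSimplex_three (t : Fin 3 → ℝ) :
    t ∈ openSimplex 3 ↔ 0 < t 0 ∧ t 0 < t 1 ∧ t 1 < t 2 ∧ t 2 < 1 := by
  simp [openSimplex, Fin.forall_fin_succ, pt]

/-- Brown's `f_σ` for `₆π = sigma6` in simplicial coordinates: `t₀(t₁−t₀)(t₂−t₁)(1−t₂) / (t₂ (t₂−t₀)(1−t₁))`. -/
theorem fSigma_sigma6 (t : Fin 3 → ℝ) :
    fSigma sigma6 t = t 0 * (t 1 - t 0) * (t 2 - t 1) * (1 - t 2) / (t 2 * (t 2 - t 0) * (1 - t 1)) := by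
  simp [fSigma, formDen, Fin.prod_univ_six, sigma6, ef, pt, max_def, min_def]

/-! ### The optimal plan and the upper bound -/

/-- The optimal doubly stochastic plan for `₆π` (rows = positions `0..5` of `sigma6 = ![0,3,1,5,2,4]`, columns = the
four gaps; positions `2, 3` carry the edges through `∞`).  Entries lie in `ℚ(√2)`. -/
def sixPlan (i : Fin 6) (w : Fin 4) : ℝ :=
  if i.val = 0 ∧ w.val = 0 then 2 - Real.sqrt 2
  else if i.val = 0 ∧ w.val = 1 then 3 * Real.sqrt 2 - 4
  else if i.val = 0 ∧ w.val = 2 then 3 - 2 * Real.sqrt 2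
  else if i.val = 1 ∧ w.val = 1 then 2 - Real.sqrt 2
  else if i.val = 1 ∧ w.val = 2 then Real.sqrt 2 - 1
  else if i.val = 4 ∧ w.val = 2 then 1 - Real.sqrt 2 / 2
  else if i.val = 4 ∧ w.val = 3 then Real.sqrt 2 / 2
  else if i.val = 5 ∧ w.val = 0 then Real.sqrt 2 - 1
  else if i.val = 5 ∧ w.val = 1 then 3 - 2 * Real.sqrt 2
  else if i.val = 5 ∧ w.val = 2 then (3 * Real.sqrt 2 - 4) / 2
  else if i.val = 5 ∧ w.val = 3 then 1 - Real.sqrt 2 / 2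
  else 0

/-- **`M_{₆π} ≤ (√2 − 1)⁴`.** -/
theorem fSup_sigma6_le_apery : fSup sigma6 ≤ (Real.sqrt 2 - 1) ^ 4 := by
  obtain ⟨hs1, hs2⟩ := sqrt_two_bounds
  set s := Real.sqrt 2 with hs
  have hsq : s ^ 2 = 2 := Real.sq_sqrt (by norm_num)
  -- the hypotheses of the weak duality bound
  have hx : ∀ i w, 0 ≤ sixPlan i w := by
    intro i w
    fin_cases i <;> fin_cases w <;> norm_num [sixPlan] <;> nlinarith
  have hsupp : ∀ i w, sixPlan i w ≠ 0 → ((sigma6 i).val ≠ 3 + 2 ∧ (sigma6 (i + 1)).val ≠ 3 + 2) ∧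
      min (sigma6 i).val (sigma6 (i + 1)).val ≤ w.val ∧ w.val < max (sigma6 i).val (sigma6 (i + 1)).val := by
    intro i w h
    fin_cases i <;> fin_cases w <;> first | decide | (exfalso; apply h; norm_num [sixPlan])
  have hrow : ∀ i, ((sigma6 i).val ≠ 3 + 2 ∧ (sigma6 (i + 1)).val ≠ 3 + 2) → ∑ w, sixPlan i w = 1 := by
    intro i hi
    fin_cases i <;> first | (exfalso; revert hi; decide) | (simp only [Fin.sum_univ_four]; norm_num [sixPlan] <;> ring)
  have hcol : ∀ w, ∑ i, sixPlan i w = 1 := by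
    intro w
    fin_cases w <;> (simp only [Fin.sum_univ_six]; norm_num [sixPlan] <;> ring)
  have h := fSup_le_exp_sum_mul_log sigma6 sigma6_bijective sixPlan hx hsupp hrow hcol
  refine h.trans (le_of_eq ?_)
  -- the entropy of the plan is `−4 log (√2 − 1)` exactly
  have hu : 0 < s - 1 := by linarith
  have hs0 : 0 < s := by linarith
  have e1 : (2 - s) = s * (s - 1) := by nlinarith
  have e2 : (3 * s - 4) = s * (s - 1) ^ 2 := by nlinarith
  have e3 : (3 - 2 * s) = (s - 1) ^ 2 := by nlinarith
  have e4 : (1 - s / 2) = s * (s - 1) / 2 := by nlinarith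
  have e6 : (3 * s - 4) / 2 = s * (s - 1) ^ 2 / 2 := by rw [e2]
  have L1 : Real.log (2 - s) = Real.log s + Real.log (s - 1) := by
    rw [e1, Real.log_mul hs0.ne' hu.ne']
  have L2 : Real.log (3 * s - 4) = Real.log s + 2 * Real.log (s - 1) := by
    rw [e2, Real.log_mul hs0.ne' (pow_ne_zero _ hu.ne'), Real.log_pow]; push_cast; ring
  have L3 : Real.log (3 - 2 * s) = 2 * Real.log (s - 1) := by
    rw [e3, Real.log_pow]; push_cast; ring
  have L4 : Real.log (1 - s / 2) = Real.log s + Real.log (s - 1) - Real.log 2 := by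
    rw [e4, Real.log_div (mul_ne_zero hs0.ne' hu.ne') two_ne_zero, Real.log_mul hs0.ne' hu.ne']
  have L5 : Real.log (s / 2) = Real.log s - Real.log 2 := by rw [Real.log_div hs0.ne' two_ne_zero]
  have L6 : Real.log ((3 * s - 4) / 2) = Real.log s + 2 * Real.log (s - 1) - Real.log 2 := by
    rw [e6, Real.log_div (mul_ne_zero hs0.ne' (pow_ne_zero _ hu.ne')) two_ne_zero,
      Real.log_mul hs0.ne' (pow_ne_zero _ hu.ne'), Real.log_pow]; push_cast; ring
  have L7 : Real.log s = Real.log 2 / 2 := by rw [hs, Real.log_sqrt (by norm_num)]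
  have hsum : ∑ i, ∑ w, sixPlan i w * Real.log (sixPlan i w) = 4 * Real.log (s - 1) := by
    simp only [Fin.sum_univ_six, Fin.sum_univ_four]
    norm_num [sixPlan]
    rw [L1, L2, L3, L4, L5, L6, L7]
    ring
  rw [hsum, show (4 : ℝ) * Real.log (s - 1) = ((4 : ℕ) : ℝ) * Real.log (s - 1) by norm_num, Real.exp_nat_mul,
    Real.exp_log hu]

/-! ### The maximiser and the exact value -/

/-- The maximiser `t* = (√2 − 1, 2 − √2, √2/2)` (gaps `(√2−1, (√2−1)², (√2−1)²/√2, 1 − 1/√2)`). -/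
def sixStar : Fin 3 → ℝ := ![Real.sqrt 2 - 1, 2 - Real.sqrt 2, Real.sqrt 2 / 2]

/-- `t*` lies in the open simplex. -/
theorem sixStar_mem : sixStar ∈ openSimplex 3 := by
  obtain ⟨hs1, hs2⟩ := sqrt_two_bounds
  rw [mem_openSimplex_three]
  simp only [sixStar, Matrix.cons_val_zero, Matrix.cons_val_one, Matrix.cons_val_two, Matrix.tail_cons,
    Matrix.head_cons]
  refine ⟨by linarith, by linarith, by linarith, by linarith⟩

/-- At `t*` the value of `f_{₆π}` is exactly `(√2 − 1)⁴`. -/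
theorem fSigma_sigma6_sixStar : fSigma sigma6 sixStar = (Real.sqrt 2 - 1) ^ 4 := by
  obtain ⟨hs1, hs2⟩ := sqrt_two_bounds
  set s := Real.sqrt 2 with hs
  have hsq : s ^ 2 = 2 := Real.sq_sqrt (by norm_num)
  have e0 : sixStar 0 = s - 1 := rfl
  have e1 : sixStar 1 = 2 - s := rfl
  have e2 : sixStar 2 = s / 2 := rfl
  rw [fSigma_sigma6, e0, e1, e2]
  have hD : s / 2 * (s / 2 - (s - 1)) * (1 - (2 - s)) ≠ 0 := by
    have h1 : (0 : ℝ) < s / 2 := by linarith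
    have h2 : (0 : ℝ) < s / 2 - (s - 1) := by linarith
    have h3 : (0 : ℝ) < 1 - (2 - s) := by linarith
    exact (mul_pos (mul_pos h1 h2) h3).ne'
  rw [div_eq_iff hD]
  linear_combination (1 / 4 * s ^ 5 - 7 / 4 * s ^ 4 + 11 / 2 * s ^ 3 - 19 / 2 * s ^ 2 + 17 / 2 * s - 3) * hsq

/-- **`M_{₆π} = (√2 − 1)⁴`** — the growth constant of Brown's six-point family is Apéry's number `17 − 12√2`.
[Brown2016, §1.5 objects; structural/elementary] -/
theorem fSup_sigma6 : fSup sigma6 = (Real.sqrt 2 - 1) ^ 4 := by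
  apply le_antisymm fSup_sigma6_le_apery
  rw [← fSigma_sigma6_sixStar]
  exact fSigma_le_fSup sigma6 sigma6_bijective sixStar_mem

/-- `(√2 − 1)⁴ = 17 − 12√2`. -/
theorem sqrt_two_sub_one_pow_four : (Real.sqrt 2 - 1) ^ 4 = 17 - 12 * Real.sqrt 2 := by
  have h : Real.sqrt 2 ^ 2 = 2 := Real.sq_sqrt (by norm_num)
  linear_combination (Real.sqrt 2 ^ 2 - 4 * Real.sqrt 2 + 8) * h

/-- **`I_{₆π}(N)^{1/N} → (√2 − 1)⁴`.** -/
theorem tendsto_six_root :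
    Tendsto (fun N : ℕ => (integral sigma6 (fun _ => (N : ℤ)) (fun _ => (N : ℤ))) ^ (1 / (N : ℝ))) atTop
      (𝓝 ((Real.sqrt 2 - 1) ^ 4)) := by
  rw [← fSup_sigma6]
  exact tendsto_integral_basic_root sigma6 sigma6_bijective (by decide)

/-- **`I_{₆π}(N) ≤ (√2 − 1)^{4N} · I_{₆π}(0)`** for every `N`. -/
theorem integral_six_le (N : ℕ) :
    integral sigma6 (fun _ => (N : ℤ)) (fun _ => (N : ℤ)) ≤
      ((Real.sqrt 2 - 1) ^ 4) ^ N * integral sigma6 (fun _ => (0 : ℤ)) (fun _ => (0 : ℤ)) := by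
  rw [← fSup_sigma6]
  exact integral_basic_le_fSup_pow sigma6 sigma6_bijective N

end Summit.KontsevichZagierPeriods.Zeta5Search.Families.Cellular
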